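import Summits.BirchSwinnertonDyer.BirchSwinnertonDyer.Theorems.EisensteinPrimesFullDescentHerbrandSplitting
import Summits.BirchSwinnertonDyer.BirchSwinnertonDyer.Theorems.EisensteinPrimesFullDescentTheoremAPrimeLocal
import Summits.BirchSwinnertonDyer.BirchSwinnertonDyer.Theorems.EisensteinPrimesFullDescentTheoremA
import HarnessLib

/-!
# Route `EisensteinPrimes`, crux 2 `GoodLatticeBDPValue` (stmt-BirchSwinnertonDyer-19032), line `halves`, road R5 / AN-5
# (the `5 ≤ p` twin T‴ of Theorem T′) — brick A-I_p: **THEOREM A-I AT AN ARBITRARY ODD PRIME `p` — from the `ω`-line `C`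
# to a rational cyclic group of order `p²` over `C`**

Cell `bsd-eis` (home `run/shared/lean/pub/bsd-eis/`), width seat `bsd-line-x1-p1-w7` (gen 7; `--supports -19032`, closes
nothing by itself). The `p`-version of LEAD g5's `FullDescentTheoremA.exists_stable_nine_of_omega_point` (p657261; road memo
`HOME/line-x1-p1-w3-g4/AN3-StubB-elementary-road.md` §2 CASE ω, steps A1–A2): for `E/ℚ` globally minimal with good
ORDINARY reduction at the odd prime `p`, a point `Q ≠ 0` of `E[p]` on which `Γ_ℚ` acts through `χ̄_p` (`C = ⟨Q⟩` the
`ω`-line), and the LOCAL input «at every finite place `v ∤ p` the inertia group (of the chosen prime) is trivial on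
`p⁻¹C / C`» (at a good place: Néron–Ogg–Shafarevich; at a split multiplicative place with `ℓ ≢ 1 (mod p)`: the level-`p²`
Tate basis — brick TA-p-loc of the road, seat w3 g13), there is a `Γ_ℚ`-STABLE subgroup `B ≤ E[p²]` of order `p²` with
`B ∩ E[p] = C` (hence cyclic): the extension `M = p⁻¹C / C` of `ω` by `𝟙` SPLITS. Assembly of landed bricks:

* A2 at `p`: w4 gen 6's ordinary kernels `Λ ≤ K₂` (`Rat.exists_ordinary_reduction_kernels_of_hasGoodReductionAtPrime`, ANY odd
  `p`): `C = Λ` (an inertia element with `χ̄_p = 2` moves `Q` by `Q`, and inertia is trivial on `E[p]/Λ`), so `K₂` is a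
  decomposition-stable complement;
* the HERBRAND splitting lemma (this seat, `FullDescentHerbrandSplitting.exists_stable_complement`: Mazur 1977 III §5 (R3) =
  Herbrand `A(ω⁻¹) = 0`, a tree theorem) at `(L, N, M) = (C, E[p], p⁻¹C)` in `V = E(ℚ̄)`, `c = p` (`#p⁻¹C = p³`: `x ↦ px` maps
  `p⁻¹C` onto `C` with kernel `E[p]`, `zsmul_geomPoints_surjective_holds`); the order of the complement `B` is `p²` by the
  second isomorphism theorem.

* §1 **`exists_stable_sq_of_omega_point_of_local`** — Theorem A-I_p with the local input at the places `v ∤ p` as a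
  HYPOTHESIS (`hloc`);
* §2 **`exists_stable_sq_of_omega_point`** — Theorem A-I_p under «every `v ∤ p` good, or split multiplicative with
  `ℓ_v ≢ 1 (mod p)`», `hloc` DISCHARGED by Néron–Ogg–Shafarevich on `E[p²]` at the good places and by seat w3 g13's brick
  TA-p-loc `FullDescentTheoremAPrime.smul_sub_mem_of_mem_absInertia_of_split_sq` at the split ones (whose §1 — the `ω`-line
  bookkeeping at level `p` — this file also consumes by name).

HONEST FRAMING: helper theorems only (0 definitions, 0 named facts, 0 sorry); Theorem A_p still needs its second half
(A-II_p: `B ⟹ ⊥`, seat w3 g13); no summit statement, no BSD / IMC / Keller–Yin theorem and no stub of the registered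
skeleton is proved by this file. References: [Mazur1977] Ch. III §5 p. 158; [SerreInventiones1972] §1.11 Prop. 11;
[SilvermanAEC2009] III.6.4, VII.4.1; [Kriz2016] Thm. 34; [NeukirchANT1999] II §9 (9.6).
-/

set_option autoImplicit false

-- the route's Theorems namespace repeats the summit name by design (D-0017 nested layout)
set_option linter.dupNamespace false

noncomputable section

open scoped Classical NumberField

namespace Summit.BirchSwinnertonDyer.BirchSwinnertonDyer.Theorems.FullDescentTheoremAIPrime

open NumberField IsDedekindDomain Field WeierstrassCurve Rat.HeightOneSpectrum
  Literature.NumberTheory.EllipticCurves Literature.NumberTheory.GaloisRepresentations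
  Summit.BirchSwinnertonDyer.BirchSwinnertonDyer.Theorems
open Summit.BirchSwinnertonDyer.BirchSwinnertonDyer.Theorems.FullDescentTheoremAPrime (smul_sub_mem_zmultiples_of_omega
  smul_sub_chi_smul_mem_torsion natCard_comap_prime smul_sub_mem_of_mem_absInertia_of_split_sq)

variable (W : WeierstrassCurve ℚ) [W.IsElliptic] {p : ℕ} [hp : Fact p.Prime]

/-! ## §1. Theorem A-I at the odd prime `p`, with the local input at `v ∤ p` as a hypothesis -/

/-- **Theorem A-I_p (road R5 / AN-5, Case `ω`, steps A1–A2), local input abstracted.** `W/ℚ` globally minimal with good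
ORDINARY reduction at the odd prime `p`; `Q ≠ 0` a point of `E[p]` with `σ Q = χ̄_p(σ) Q`; `hloc`: at every finite place
`v ∤ p`, every element of the local inertia group moves each `x` with `px ∈ ⟨Q⟩` inside `⟨Q⟩` (brick TA-p-loc: true when
`v` is good, or split multiplicative with `ℓ_v ≢ 1 (mod p)`). Then there is a `Γ_ℚ`-stable subgroup `B ≤ E[p²]` of order
`p²` containing `C = ⟨Q⟩` with `B ∩ E[p] = C` — `B` is CYCLIC of order `p²` with `pB = C`: the sequence
`0 → E[p]/C → p⁻¹C/C → C → 0` splits over `Γ_ℚ` (Herbrand splitting `FullDescentHerbrandSplitting.exists_stable_complement` at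
`c = p`, fed with `hloc` and Serre's ordinary kernels `C = Λ ≤ K₂` at `p`).
[cite: Mazur1977, Ch. III §5 p. 158] [cite: SerreInventiones1972, §1.11 Prop. 11] [cite: Kriz2016, Thm. 34 (2)–(3)] -/
theorem exists_stable_sq_of_omega_point_of_local [W.IsGloballyMinimal] (hp2 : p ≠ 2)
    (hgood : W.HasGoodReductionAtPrime p) (hord : ¬ (p : ℤ) ∣ W.frobeniusTrace p)
    (Q : geomTorsion W (p : ℤ)) (hQ0 : Q ≠ 0)
    (hQ : ∀ σ : absoluteGaloisGroup ℚ, σ • Q = ((modNCyclotomicCharacter ℚ p σ : (ZMod p)ˣ) : ZMod p).val • Q)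
    (hloc : ∀ v : HeightOneSpectrum (𝓞 ℚ), natGenerator v ≠ p →
      ∀ τ ∈ absInertia (v.adicCompletion ℚ), ∀ x : geomPoints W,
        (p : ℤ) • x ∈ AddSubgroup.zmultiples (Q : geomPoints W) →
        absGaloisRestrict ℚ (v.adicCompletion ℚ) τ • x - x ∈ AddSubgroup.zmultiples (Q : geomPoints W)) :
    ∃ B : AddSubgroup (geomPoints W),
      AddSubgroup.zmultiples (Q : geomPoints W) ≤ B ∧ B ≤ geomTorsion W ((p ^ 2 : ℕ) : ℤ) ∧ Nat.card B = p ^ 2 ∧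
      B ⊓ geomTorsion W (p : ℤ) = AddSubgroup.zmultiples (Q : geomPoints W) ∧
      ∀ σ : absoluteGaloisGroup ℚ, ∀ x ∈ B, σ • x ∈ B := by
  have hpp : p.Prime := hp.out
  haveI : Fact (1 < p) := ⟨hpp.one_lt⟩
  -- notation-free abbreviations
  have hQM : (Q : geomPoints W) ∈ geomTorsion W (p : ℤ) := Q.2
  have hQp : (p : ℤ) • (Q : geomPoints W) = 0 := mem_torsionBy_iff.mp Q.2
  have hCN : AddSubgroup.zmultiples (Q : geomPoints W) ≤ geomTorsion W (p : ℤ) :=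
    AddSubgroup.zmultiples_le_of_mem hQM
  have hNM : geomTorsion W (p : ℤ) ≤ (AddSubgroup.zmultiples (Q : geomPoints W)).comap (zsmulAddGroupHom (p : ℤ)) := by
    intro x hx
    rw [AddSubgroup.mem_comap, zsmulAddGroupHom_apply]
    rw [mem_torsionBy_iff] at hx
    rw [hx]
    exact AddSubgroup.zero_mem _
  have hsq : (((p ^ 2 : ℕ) : ℤ)) = (p : ℤ) * (p : ℤ) := by push_cast; ring
  have hMsq : (AddSubgroup.zmultiples (Q : geomPoints W)).comap (zsmulAddGroupHom (p : ℤ)) ≤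
      geomTorsion W ((p ^ 2 : ℕ) : ℤ) := by
    intro x hx
    rw [AddSubgroup.mem_comap, zsmulAddGroupHom_apply] at hx
    obtain ⟨k, hk⟩ := AddSubgroup.mem_zmultiples_iff.mp hx
    rw [mem_torsionBy_iff, hsq, mul_smul, ← hk, smul_comm, hQp, smul_zero]
  -- cardinalities
  have hcC : Nat.card (AddSubgroup.zmultiples (Q : geomPoints W)) = p := by
    rw [Nat.card_zmultiples, AddSubgroup.addOrderOf_coe, addOrderOf_eq_of_ne_zero W p hQ0]
  have hcN : Nat.card (geomTorsion W (p : ℤ)) = p * p := by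
    rw [Literature.NumberTheory.EllipticCurves.natCard_geomTorsion W p, sq]
  have hcM : Nat.card ((AddSubgroup.zmultiples (Q : geomPoints W)).comap (zsmulAddGroupHom (p : ℤ))) = p ^ 2 * p :=
    natCard_comap_prime W hQ0
  -- the place above `p`; `C = Λ ≤ K₂`
  obtain ⟨v₀, hv₀'⟩ : ∃ v₀ : HeightOneSpectrum (𝓞 ℚ), primesEquiv v₀ = ⟨p, hpp⟩ :=
    ⟨(primesEquiv (R := 𝓞 ℚ)).symm ⟨p, hpp⟩, Equiv.apply_symm_apply _ _⟩
  have hv₀ : natGenerator v₀ = p := congrArg Subtype.val hv₀'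
  have hpv₀ : ((p : ℕ) : 𝓞 ℚ) ∈ v₀.asIdeal := (Rat.natCast_mem_asIdeal_iff v₀).mpr (hv₀ ▸ dvd_refl _)
  obtain ⟨Λ, K₂, hΛle, hΛcard, hK₂le, hK₂card, hK₂inf, hΛst, hK₂st, hΛquot, -, -, hΛχ, -⟩ :=
    FullDescentOrdinaryNine.Rat.exists_ordinary_reduction_kernels_of_hasGoodReductionAtPrime W p hp2 hgood hord v₀ hpv₀
  have hCΛ : AddSubgroup.zmultiples (Q : geomPoints W) = Λ := by
    -- `Q ∈ Λ`: `τ₀ Q − Q = 2Q − Q = Q ∈ Λ` for `τ₀ ∈ I_p` with `χ̄_p(res τ₀) = 2`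
    have h2u : IsUnit (2 : ZMod p) := by
      rw [show (2 : ZMod p) = ((2 : ℕ) : ZMod p) by norm_cast, ZMod.isUnit_iff_coprime]
      exact (Nat.coprime_primes Nat.prime_two hpp).mpr (Ne.symm hp2)
    obtain ⟨τ, hτ, hτχ⟩ :=
      FullDescentOrdinaryNine.Rat.exists_mem_absInertia_modNCyclotomicCharacter_absGaloisRestrict_eq p v₀ hpv₀ h2u.unit
    have h2val : ((h2u.unit : (ZMod p)ˣ) : ZMod p).val = 2 := by
      rw [IsUnit.unit_spec, show (2 : ZMod p) = ((2 : ℕ) : ZMod p) by norm_cast, ZMod.val_natCast,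
        Nat.mod_eq_of_lt (lt_of_le_of_ne hpp.two_le (Ne.symm hp2))]
    have hQΛ : (Q : geomPoints W) ∈ Λ := by
      have h := hΛquot τ hτ (Q : geomPoints W) hQM
      have hQc : absGaloisRestrict ℚ (v₀.adicCompletion ℚ) τ • (Q : geomPoints W) = (2 : ℕ) • (Q : geomPoints W) := by
        rw [← AddSubgroup.torsionBy.coe_smul, hQ, hτχ, AddSubgroupClass.coe_nsmul, h2val]
      rwa [hQc, two_nsmul, add_sub_cancel_right] at h
    haveI : Finite Λ := Nat.finite_of_card_ne_zero (by rw [hΛcard]; exact hpp.ne_zero)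
    exact AddSubgroup.eq_of_le_of_card_ge (AddSubgroup.zmultiples_le_of_mem hQΛ) (by rw [hΛcard, hcC])
  -- the Herbrand splitting lemma at `(C, E[p], p⁻¹C)`
  obtain ⟨B, hCB, hBM, hBN, hNB, hBst⟩ := FullDescentHerbrandSplitting.exists_stable_complement (V := geomPoints W) hp2
    (AddSubgroup.zmultiples (Q : geomPoints W)) (geomTorsion W (p : ℤ))
    ((AddSubgroup.zmultiples (Q : geomPoints W)).comap (zsmulAddGroupHom (p : ℤ))) hCN hNM
    hpp.ne_zero hcC hcN hcM
    (fun σ x hx ↦ by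
      obtain ⟨k, rfl⟩ := AddSubgroup.mem_zmultiples_iff.mp hx
      rw [FullDescentTateAlgebra.smul_zsmul_comm]
      exact AddSubgroup.zsmul_mem _ (by
        rw [← AddSubgroup.torsionBy.coe_smul, hQ σ, AddSubgroupClass.coe_nsmul]
        exact AddSubgroup.nsmul_mem _ (AddSubgroup.mem_zmultiples _) _) _)
    (fun x hx ↦ by rw [AddSubgroup.mem_comap, zsmulAddGroupHom_apply] at hx; exact hx)
    (fun σ x hx ↦ smul_sub_mem_zmultiples_of_omega W hQ0 hQ σ hx)
    (fun σ x hx ↦ smul_sub_chi_smul_mem_torsion W hQ σ (by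
      rw [AddSubgroup.mem_comap, zsmulAddGroupHom_apply] at hx; exact hx))
    (fun x _ ↦ W.isOpen_stabilizer_point_holds x)
    (fun v hv ↦ by
      refine ⟨adicCompletionPrime ℚ v, adicCompletionPrime_mem_primesAbove ℚ v, fun τ hτ x hx ↦ ?_⟩
      rw [inertia_adicCompletionPrime_eq_map_absInertia ℚ v] at hτ
      obtain ⟨τ', hτ', rfl⟩ := Subgroup.mem_map.mp hτ
      have hx' : (p : ℤ) • x ∈ AddSubgroup.zmultiples (Q : geomPoints W) := by
        rw [AddSubgroup.mem_comap, zsmulAddGroupHom_apply] at hx; exact hx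
      exact hloc v hv τ' hτ' x hx')
    hv₀
    ⟨K₂, by rw [hCΛ, ← hK₂inf]; exact inf_le_left, fun x hx ↦ by
        rw [AddSubgroup.mem_comap, zsmulAddGroupHom_apply, hCΛ, ← hK₂inf]
        refine AddSubgroup.mem_inf.mpr ⟨K₂.zsmul_mem hx p, ?_⟩
        have hxsq : ((p ^ 2 : ℕ) : ℤ) • x = 0 := mem_torsionBy_iff.mp (hK₂le hx)
        rw [mem_torsionBy_iff, smul_smul, ← hsq]
        exact hxsq,
      by rw [hK₂card, sq], by rw [hK₂inf, hCΛ], fun δ hδ x hx ↦ by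
        obtain ⟨σ, rfl⟩ := (GreenbergSelmer.mem_decomp_iff v₀ δ).mp hδ
        exact hK₂st σ x hx⟩
  -- `#B = p²` by the second isomorphism theorem: `B/(B ⊓ E[p]) ≅ (B ⊔ E[p])/E[p] = p⁻¹C/E[p]`
  refine ⟨B, hCB, hBM.trans hMsq, ?_, hBN, hBst⟩
  have hq : Nat.card (B ⧸ (geomTorsion W (p : ℤ)).addSubgroupOf B) =
      Nat.card (↥(B ⊔ geomTorsion W (p : ℤ)) ⧸
        (geomTorsion W (p : ℤ)).addSubgroupOf (B ⊔ geomTorsion W (p : ℤ))) :=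
    Nat.card_congr (QuotientAddGroup.quotientInfEquivSumNormalQuotient B (geomTorsion W (p : ℤ))).toEquiv
  have hinB : Nat.card ((geomTorsion W (p : ℤ)).addSubgroupOf B) = p := by
    rw [← AddSubgroup.inf_addSubgroupOf_right,
      Nat.card_congr (AddSubgroup.addSubgroupOfEquivOfLe (inf_le_right : geomTorsion W (p : ℤ) ⊓ B ≤ B)).toEquiv,
      inf_comm, hBN, hcC]
  have hinBN : Nat.card ((geomTorsion W (p : ℤ)).addSubgroupOf (B ⊔ geomTorsion W (p : ℤ))) = p * p := by
    rw [Nat.card_congr (AddSubgroup.addSubgroupOfEquivOfLe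
      (le_sup_right : geomTorsion W (p : ℤ) ≤ B ⊔ geomTorsion W (p : ℤ))).toEquiv, hcN]
  have h1 := AddSubgroup.card_eq_card_quotient_mul_card_addSubgroup ((geomTorsion W (p : ℤ)).addSubgroupOf B)
  have h2 := AddSubgroup.card_eq_card_quotient_mul_card_addSubgroup
    ((geomTorsion W (p : ℤ)).addSubgroupOf (B ⊔ geomTorsion W (p : ℤ)))
  have hBNcard : Nat.card ↥(B ⊔ geomTorsion W (p : ℤ)) = p ^ 2 * p := by rw [sup_comm, hNB, hcM]
  rw [hinB, hq] at h1
  rw [hinBN, hBNcard] at h2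
  -- `h2 : p² · p = q · (p · p)`, so `q = p` and `#B = q · p = p²`
  have hq' : Nat.card (↥(B ⊔ geomTorsion W (p : ℤ)) ⧸
      (geomTorsion W (p : ℤ)).addSubgroupOf (B ⊔ geomTorsion W (p : ℤ))) = p := by
    have h3 : Nat.card (↥(B ⊔ geomTorsion W (p : ℤ)) ⧸
        (geomTorsion W (p : ℤ)).addSubgroupOf (B ⊔ geomTorsion W (p : ℤ))) * (p * p) = p * (p * p) := by
      rw [← h2]; ring
    exact Nat.eq_of_mul_eq_mul_right (Nat.mul_pos hpp.pos hpp.pos) h3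
  rw [h1, hq', sq]

/-! ## §2. Theorem A-I at the odd prime `p` -/

/-- **Theorem A-I_p (road R5 / AN-5, Case `ω`, steps A1–A2).** `W/ℚ` globally minimal with good ORDINARY reduction at the odd
prime `p`; every finite place `v ∤ p` good, or split multiplicative with residue characteristic `≢ 1 (mod p)`; `Q ≠ 0` a point
of `E[p]` with `σ Q = χ̄_p(σ) Q`. Then there is a `Γ_ℚ`-stable subgroup `B ≤ E[p²]` of order `p²` containing `C = ⟨Q⟩` with
`B ∩ E[p] = C` — `B` is CYCLIC of order `p²` with `pB = C`. (`exists_stable_sq_of_omega_point_of_local` with `hloc` discharged: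
Néron–Ogg–Shafarevich on `E[p²]` at a good `v`, TA-p-loc `smul_sub_mem_of_mem_absInertia_of_split_sq` at a split `v`.)
[cite: Mazur1977, Ch. III §5 p. 158] [cite: SerreInventiones1972, §1.11 Prop. 11] [cite: Kriz2016, Thm. 34 (2)–(3)]
[cite: SilvermanAEC2009, VII.4.1] -/
theorem exists_stable_sq_of_omega_point [W.IsGloballyMinimal] (hp2 : p ≠ 2)
    (hgood : W.HasGoodReductionAtPrime p) (hord : ¬ (p : ℤ) ∣ W.frobeniusTrace p)
    (hH : ∀ v : HeightOneSpectrum (𝓞 ℚ), natGenerator v ≠ p →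
      W.HasGoodReductionAt v ∨ (W.HasSplitMultiplicativeReductionAt v ∧ ¬ natGenerator v ≡ 1 [MOD p]))
    (Q : geomTorsion W (p : ℤ)) (hQ0 : Q ≠ 0)
    (hQ : ∀ σ : absoluteGaloisGroup ℚ, σ • Q = ((modNCyclotomicCharacter ℚ p σ : (ZMod p)ˣ) : ZMod p).val • Q) :
    ∃ B : AddSubgroup (geomPoints W),
      AddSubgroup.zmultiples (Q : geomPoints W) ≤ B ∧ B ≤ geomTorsion W ((p ^ 2 : ℕ) : ℤ) ∧ Nat.card B = p ^ 2 ∧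
      B ⊓ geomTorsion W (p : ℤ) = AddSubgroup.zmultiples (Q : geomPoints W) ∧
      ∀ σ : absoluteGaloisGroup ℚ, ∀ x ∈ B, σ • x ∈ B := by
  have hpp : p.Prime := hp.out
  refine exists_stable_sq_of_omega_point_of_local W hp2 hgood hord Q hQ0 hQ (fun v hv τ hτ x hx ↦ ?_)
  have hQp : (p : ℤ) • (Q : geomPoints W) = 0 := mem_torsionBy_iff.mp Q.2
  rcases hH v hv with hgoodv | ⟨hsplit, hmod⟩
  · -- Néron–Ogg–Shafarevich on `E[p²]`: inertia at a good `v ∤ p` fixes `x` (`p² x = 0`)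
    have hn : ((((p ^ 2 : ℕ) : ℤ)) : 𝓞 ℚ) ∉ v.asIdeal := by
      rw [Int.cast_natCast]
      intro h
      have hdvd := (Rat.natCast_mem_asIdeal_iff v).mp h
      have hvp : natGenerator v ∣ p := (Nat.Prime.dvd_of_dvd_pow (prime_natGenerator v) hdvd)
      exact hv ((Nat.prime_dvd_prime_iff_eq (prime_natGenerator v) hpp).mp hvp)
    have hxsq : ((p ^ 2 : ℕ) : ℤ) • x = 0 := by
      obtain ⟨k, hk⟩ := AddSubgroup.mem_zmultiples_iff.mp hx
      rw [show ((p ^ 2 : ℕ) : ℤ) = (p : ℤ) * (p : ℤ) by push_cast; ring, mul_smul, ← hk, smul_comm, hQp, smul_zero]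
    have h := W.smul_eq_of_mem_absInertia_of_hasGoodReductionAt hgoodv hn hτ hxsq
    have h' : absGaloisRestrict ℚ (v.adicCompletion ℚ) τ • x = x := h
    rw [h', sub_self]
    exact AddSubgroup.zero_mem _
  · exact smul_sub_mem_of_mem_absInertia_of_split_sq W hv hsplit hmod hQ0 hQ hτ hx

end Summit.BirchSwinnertonDyer.BirchSwinnertonDyer.Theorems.FullDescentTheoremAIPrime

end
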